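import Summits.BirchSwinnertonDyer.Rank1Residual.JET.RingClassTransverseLocal
import Literature.NumberTheory.EllipticCurves.KolyvaginPrimeTorsionFixingOfIndex
import Literature.NumberTheory.EllipticCurves.HeegnerPointsKolyvaginPrimaryRamifiedProofs
import HarnessLib

/-!
# McCallum 1991, Prop. 4.4 in ORDER form at a ZHANG–Kolyvagin prime (index `≥ M`), modulo the reduction datum —
# the tree's `zsmul_kolyvaginClass_mem_selmerLocalKer_iff_of_isKolyvaginPrime` RE-KEYED from Gross's (3.2)
# `Frob(ℓ) = Frob(∞)` on `E_{p^M}` to W. Zhang's numerical condition `p^M ∣ ℓ + 1`, `p^M ∣ a_ℓ` (image-free)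
# (cell `bsd-stepL`, seat `bsd-stepL-corner-p1` g9; `--supports stmt-BirchSwinnertonDyer-19947`; memo CORNER-G9 §3)

WHY. The corner's Kolyvagin levels (crux 19947 `stub_kolyJ_max`, tam3's walk for 19109, bsd-jet's road K) are products of
Kolyvagin primes in W. ZHANG's sense (`Zhang2014.IsKolyvaginPrime` + `kolyvaginIndex ≥ M`): without surjectivity of `ρ̄_{E,p}`
this is WEAKER than Gross's (3.2) at level `p^M` (`FrobEqFrobInfty W K (p^M) ℓ`), which the tree's McCallum-Prop.-4.4
theorem `zsmul_kolyvaginClass_mem_selmerLocalKer_iff_of_isKolyvaginPrime` (file `HeegnerPointsKolyvaginPrimaryRamifiedProofs`,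
§5: Prop. 4.4 in order form GRANTED the reduction datum `hdata`) assumes. That theorem uses (3.2) only to produce an arithmetic
Frobenius at `𝔓 ∣ λ` FIXING `E[p^M]` and the local torsion `E(K̄)[p^M] ≃ E(K̄_λ)[p^M]` — both available at Zhang primes
from the congruences alone (tree `exists_isArithFrobAt_mem_torsionFixing_of_le_kolyvaginIndex`, Jetchev §3.2; good reduction
at `ℓ ∤ N` by `JET.RingClassTransverse.hasGoodReductionAt_of_zhangKolyvagin`). So:
* **`zsmul_kolyvaginClass_mem_selmerLocalKer_iff_of_le_kolyvaginIndex`** — the SAME statement and proof with the binder pair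
  (`IsKolyvaginPrime N W K p ℓ`, `FrobEqFrobInfty W K (p^M) ℓ`) replaced by (`Zhang2014.IsKolyvaginPrime (W.conductorNorm ℤ) W K p ℓ`,
  `M ≤ Zhang2014.kolyvaginIndex W p ℓ`): for every `k`, `k • c(P₁)` is Selmer at `λ` iff `k • c(P₂)` dies in `H¹(K_λ, E[p^M])`,
  granted `hdata` (the reduction map `red` with its Frobenius `φ`, the `Ẽ(𝔽_λ)`-arithmetic, the inertia action through `⟨τ₀⟩`
  and the Euler-system root `R₀` with `red R₀ = l'·φ(red P₂) − a'·red P₂` — x11b3's `KolyvaginH44.exists_reductionDatum` +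
  Gross Prop. 3.7 (2) supply it for coherent concrete data; cf. `…Prop44DerivedRoot` for the root in group-ring currency).
This is the Zhang-currency door through which x11b3's `h44` programme (`KolyvaginH44Concrete.h44_concrete_of_traceRelation_of_congruence`,
labelled remainder {(γ) = Gross 3.7 (2)}) reaches the corner's `h47` ∕ `h44c`. HONEST FRAMING: one theorem, a re-keying of a
tree theorem; no definition ∕ fact ∕ sorry; CONDITIONAL on `hdata`; nothing about BSD; no stub closes; T7.
References: [McCallumLMS1991] §4 Prop. 4.4, Lemma 4.3; [GrossLMS1991] §3 (3.2)–(3.3), Prop. 6.2 (2); [Jetchev2008] §3.2;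
[WZhang2014] Notations (xii).
-/

set_option autoImplicit false
set_option linter.dupNamespace false

noncomputable section

open scoped Classical NumberField

namespace Summit.BirchSwinnertonDyer.BirchSwinnertonDyer.Theorems.Prop44

open WeierstrassCurve NumberField IsDedekindDomain Field
  Literature.NumberTheory.EllipticCurves Literature.NumberTheory.GaloisRepresentations
  Literature.NumberTheory.EllipticCurves.KolyvaginCocycle

-- `K : Type`: the tree's ring-class class field theory (JET bricks) is universe `0`.
variable {K : Type} [Field K] [NumberField K] (W : WeierstrassCurve ℚ) [W.IsElliptic] [W.IsGloballyMinimal]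

/-- **McCallum's Prop. 4.4 in order form at a ZHANG–Kolyvagin prime of index `≥ M`, granted the reduction datum** —
the tree's `zsmul_kolyvaginClass_mem_selmerLocalKer_iff_of_isKolyvaginPrime` with Gross's (3.2) replaced by Zhang's congruences:
for `E = W/ℚ` globally minimal over the imaginary quadratic `K`, `p` odd, `ℓ` a Zhang–Kolyvagin prime (`ℓ ∤ N_E d_K p`, inert)
with `M ≤ M(ℓ)`, the place `λ ∋ ℓ`, admissible `A₁, A₂` with invariant `P₁, P₂`, `c(P₂)` Selmer at `λ`, `ℓ + 1 = p^M l'`,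
`a = p^M a'`, and `hdata` VERBATIM as there: `k • c(P₁) ∈ Sel_λ ⟺ k • c(P₂)_λ = 0` for every `k`. Proof = the tree's, with
the Frobenius fixing `E[p^M]` from `exists_isArithFrobAt_mem_torsionFixing_of_le_kolyvaginIndex` and good reduction from
`ℓ ∤ N_E`. [cite: McCallumLMS1991, §4 Prop. 4.4] [cite: GrossLMS1991, Prop. 6.2 (2)] [cite: Jetchev2008, §3.2 (arXiv p. 10)] -/
theorem zsmul_kolyvaginClass_mem_selmerLocalKer_iff_of_le_kolyvaginIndex
    (hK : IsImaginaryQuadratic K) {p : ℕ} (hp : p.Prime) (hp2 : p ≠ 2) {M ℓ : ℕ}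
    (hℓ : Zhang2014.IsKolyvaginPrime (W.conductorNorm ℤ) W K p ℓ) (hℓM : M ≤ Zhang2014.kolyvaginIndex W p ℓ)
    {v : HeightOneSpectrum (𝓞 K)} (hv : (ℓ : 𝓞 K) ∈ v.asIdeal)
    {hdiv : ∀ P : geomPoints (W.baseChange K), ∃ Q : geomPoints (W.baseChange K),
      ((p ^ M : ℕ) : ℤ) • Q = P}
    {A₁ A₂ : AddSubgroup (geomPoints (W.baseChange K))}
    (hA₁ : IsAdmissible (absoluteGaloisGroup K) A₁ ((p ^ M : ℕ) : ℤ))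
    (hA₂ : IsAdmissible (absoluteGaloisGroup K) A₂ ((p ^ M : ℕ) : ℤ))
    {P₁ P₂ : geomPoints (W.baseChange K)}
    (hP₁ : P₁ ∈ invPoints (absoluteGaloisGroup K) A₁ ((p ^ M : ℕ) : ℤ))
    (hP₂ : P₂ ∈ invPoints (absoluteGaloisGroup K) A₂ ((p ^ M : ℕ) : ℤ))
    (hsel₂ : kolyvaginClass (W.baseChange K) _ hdiv hA₂ P₂ hP₂ ∈
      selmerLocalKer (W.baseChange K) (v.adicCompletion K) ((p ^ M : ℕ) : ℤ))
    {a l' a' : ℤ} (hl' : ((ℓ + 1 : ℕ) : ℤ) = (p : ℤ) ^ M * l') (ha' : a = (p : ℤ) ^ M * a')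
    (hdata : ∀ 𝔓 ∈ v.primesAbove, ∀ F : absoluteGaloisGroup K, IsArithFrobAt (𝓞 K) F 𝔓 →
      F ∈ torsionFixing (W.baseChange K) ((p ^ M : ℕ) : ℤ) →
      F • P₂ = P₂ ∧
      ∃ (B : Type) (_ : AddCommGroup B) (red : geomPoints (W.baseChange K) →+ B) (φ : B →+ B)
        (τ₀ : absoluteGaloisGroup K) (R₀ : geomPoints (W.baseChange K)),
        (∀ τ ∈ 𝔓.inertia (absoluteGaloisGroup K), ∀ x : geomPoints (W.baseChange K),
          red (τ • x) = red x) ∧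
        (∀ x : geomPoints (W.baseChange K), red (F • x) = φ (φ (red x))) ∧
        (∀ x : geomPoints (W.baseChange K), ((p ^ M : ℕ) : ℤ) • x = 0 → red x = 0 → x = 0) ∧
        (∀ b : B, ((p ^ M : ℕ) : ℤ) • b = 0 → φ (φ b) = b) ∧
        (∀ b : B, φ (φ b) = b → IsOfFinAddOrder b) ∧
        (∀ b : B, φ (φ b) = b → ((ℓ + 1 : ℕ) : ℤ) • b = a • φ b) ∧
        (∀ s : ℤ, s = 1 ∨ s = -1 → ∃ (g : B) (e : ℕ), φ g = s • g ∧ addOrderOf g = p ^ e ∧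
          (p : ℤ) ^ e ∣ ((ℓ + 1 : ℕ) : ℤ) - s * a ∧
          ¬ (p : ℤ) ^ (e + 1) ∣ ((ℓ + 1 : ℕ) : ℤ) - s * a ∧
          ∀ c : B, φ c = s • c → (∃ k : ℕ, ((p : ℤ) ^ k) • c = 0) → ∃ i : ℤ, c = i • g) ∧
        τ₀ ∈ 𝔓.inertia (absoluteGaloisGroup K) ∧
        (∀ τ ∈ 𝔓.inertia (absoluteGaloisGroup K), ∃ i : ℕ, ∀ x ∈ A₁, τ • x = (τ₀ ^ i) • x) ∧
        R₀ ∈ A₁ ∧ ((p ^ M : ℕ) : ℤ) • R₀ = τ₀ • P₁ - P₁ ∧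
        red R₀ = l' • φ (red P₂) - a' • red P₂)
    (k : ℤ) :
    k • kolyvaginClass (W.baseChange K) _ hdiv hA₁ P₁ hP₁ ∈
        selmerLocalKer (W.baseChange K) (v.adicCompletion K) ((p ^ M : ℕ) : ℤ) ↔
      k • kolyvaginClass (W.baseChange K) _ hdiv hA₂ P₂ hP₂ ∈
        (W.baseChange K).torsionLocalKer (v.adicCompletion K) ((p ^ M : ℕ) : ℤ) := by
  haveI : CharZero (v.adicCompletion K) :=
    charZero_of_injective_algebraMap (algebraMap K (v.adicCompletion K)).injective
  haveI : (W.baseChange K).IsElliptic := inferInstanceAs (W.map (algebraMap ℚ K)).IsElliptic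
  haveI : Fact p.Prime := ⟨hp⟩
  have hq0 : p ^ M ≠ 0 := pow_ne_zero M hp.ne_zero
  -- good reduction at `λ` (`ℓ ∤ N_E`) and at the ℚ-place below; `λ ∤ p`
  have hgood : (W.baseChange K).HasGoodReductionAt v :=
    (Summit.BirchSwinnertonDyer.Rank1Residual.JET.RingClassTransverse.hasGoodReductionAt_of_zhangKolyvagin
      W K hp hℓ v hv M).1
  have hℓv : (ℓ : 𝓞 ℚ) ∈ (v.under (𝓞 ℚ)).asIdeal := by
    change (ℓ : 𝓞 ℚ) ∈ v.asIdeal.under (𝓞 ℚ)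
    rw [Ideal.under_def, Ideal.mem_comap, map_natCast]; exact hv
  have hgoodQ : W.HasGoodReductionAt (v.under (𝓞 ℚ)) :=
    Summit.BirchSwinnertonDyer.Rank1Residual.X11b.Three.Koly.Method2.LocalFrob.hasGoodReductionAt_rat_of_not_dvd_conductorNorm
      W hℓ.1 hℓ.2.1 _ hℓv
  have hpv : (p : 𝓞 K) ∉ v.asIdeal := not_natCast_mem_of_prime_ne hℓ.1 hp hℓ.2.2.2.1 v hv
  -- the local prime and an arithmetic Frobenius at it fixing `E[p^M]`
  obtain ⟨𝔐, h𝔐⟩ := v.localPrimesAbove_nonempty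
  have h𝔓 : v.primeBelow (closureEmb (K := K) (v.adicCompletion K)) 𝔐 ∈ v.primesAbove :=
    HeightOneSpectrum.primeBelow_mem_primesAbove h𝔐
  obtain ⟨F, hF, hFfix⟩ :=
    exists_isArithFrobAt_mem_torsionFixing_of_le_kolyvaginIndex W hK hℓ hℓM hℓv hgoodQ hv h𝔓
  obtain ⟨hFP₂, B, _, red, φ, τ₀, R₀, hredI, hredF, hred, hBn, htors, hchar, hcyc, hτ₀, hIτ₀,
    hR₀A, hR₀, hR₀red⟩ := hdata _ h𝔓 F hF hFfix
  exact zsmul_kolyvaginClass_mem_selmerLocalKer_iff_mem_torsionLocalKer (W.baseChange K) hp hp2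
    hA₁ hA₂ hP₁ hP₂ hgood hpv h𝔐 hF hFfix
    (torsionPointsMap_bijective (W.baseChange K) (v.adicCompletion K) hq0).2 red φ hredI
    hredF hred hBn hl' ha' htors hchar hcyc hτ₀ hIτ₀ hR₀A hR₀ hR₀red hFP₂ hsel₂ k

end Summit.BirchSwinnertonDyer.BirchSwinnertonDyer.Theorems.Prop44

end
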